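import Mathlib.Tactic

/-!
# THE (Cap)(iii) BOUND OF THE UNIFORM INNER PAYMENT `σ = 4/(3f)` (night-3 g15)
`capiii_sigma`: for `c ≤ g − 1`, `2(g − 1) ≤ q + 2` and `7(g − 1) ≤ 3(q + 1)` (every `f ≥ q`), the load of a `(q+2)`-set not containing the
`g`-circuit, `c + c (q + 2 − c) σ` with `c` coloops and at most `c (q + 2 − c)` σ-loaders, is at most `q + 1`: `c (q + 2 − c) ≤ (g − 1)(q + 3 − g)`
on the monotone range, `(g − 1)(q + 3 − g) ≤ (g − 1) q ≤ (g − 1) f`, so the σ-part is `≤ 4(g − 1)/3` and the total `≤ 7(g − 1)/3 ≤ q + 1`.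
The hypothesis of `C025ProfileThinGirthD` in one lemma, for every `g`. No matroid in this file.
-/

namespace PercRepro
namespace ThinGirth

/-- `c (q + 2 − c) ≤ (g − 1)(q + 3 − g)` for `c ≤ g − 1` and `2 (g − 1) ≤ q + 2` (the product `c (q + 2 − c)` increases up to `(q + 2)/2`). -/
theorem prod_le_of_le {c g q : ℕ} (hc : c + 1 ≤ g) (hg : 2 * (g - 1) ≤ q + 2) (hg1 : 1 ≤ g) :
    c * (q + 2 - c) ≤ (g - 1) * (q + 3 - g) := by
  obtain ⟨d, hd⟩ : ∃ d, g - 1 = c + d := ⟨g - 1 - c, by omega⟩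
  have e : q + 2 - c = q + 3 - g + d := by omega
  rw [hd, e]
  have h2 : c + d + (c + d) ≤ q + 3 - g + d + c := by omega
  nlinarith

/-- **The (Cap)(iii) bound for `σ = 4/(3f)`**: `c + c (q + 2 − c) · 4/(3f) ≤ q + 1` for `c ≤ g − 1`, `2(g − 1) ≤ q + 2`, `7(g − 1) ≤ 3(q + 1)`,
`f ≥ q` (`f > 0`). -/
theorem capiii_sigma {g q f c : ℕ} (hg3 : 3 ≤ g) (hc : c + 1 ≤ g) (hg : 2 * (g - 1) ≤ q + 2) (h7 : 7 * (g - 1) ≤ 3 * (q + 1))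
    (hqf : q ≤ f) (hf0 : 0 < f) :
    (c : ℚ) + ((c * (q + 2 - c) : ℕ) : ℚ) * (4 / (3 * (f : ℚ))) ≤ q + 1 := by
  have h1 : c * (q + 2 - c) ≤ (g - 1) * f := by
    have hqg : q + 3 - g ≤ f := by omega
    calc c * (q + 2 - c) ≤ (g - 1) * (q + 3 - g) := prod_le_of_le hc hg (by omega)
      _ ≤ (g - 1) * f := Nat.mul_le_mul_left _ hqg
  have hfpos : (0 : ℚ) < f := by exact_mod_cast hf0
  have h1' : ((c * (q + 2 - c) : ℕ) : ℚ) ≤ ((g - 1 : ℕ) : ℚ) * f := by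
    have h1c : ((c * (q + 2 - c) : ℕ) : ℚ) ≤ (((g - 1) * f : ℕ) : ℚ) := Nat.cast_le.mpr h1
    have hgf : (((g - 1) * f : ℕ) : ℚ) = ((g - 1 : ℕ) : ℚ) * (f : ℚ) := Nat.cast_mul _ _
    rw [hgf] at h1c
    exact h1c
  have h2 : ((c * (q + 2 - c) : ℕ) : ℚ) * (4 / (3 * (f : ℚ))) ≤ ((g - 1 : ℕ) : ℚ) * (4 / 3) := by
    have hσ : (0 : ℚ) ≤ 4 / (3 * (f : ℚ)) := by positivity
    calc ((c * (q + 2 - c) : ℕ) : ℚ) * (4 / (3 * (f : ℚ))) ≤ ((g - 1 : ℕ) : ℚ) * f * (4 / (3 * (f : ℚ))) :=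
          mul_le_mul_of_nonneg_right h1' hσ
      _ = ((g - 1 : ℕ) : ℚ) * (4 / 3) := by field_simp
  have hc' : (c : ℚ) ≤ ((g - 1 : ℕ) : ℚ) := by exact_mod_cast (by omega : c ≤ g - 1)
  have h7' : 7 * ((g - 1 : ℕ) : ℚ) ≤ 3 * ((q : ℚ) + 1) := by
    have : ((7 * (g - 1) : ℕ) : ℚ) ≤ ((3 * (q + 1) : ℕ) : ℚ) := by exact_mod_cast h7
    push_cast at this
    linarith
  linarith

end ThinGirth
end PercRepro
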